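import Summits.AnomalousDissipation.AnomalousDissipation.Theorems.BaireTransferRobustLoudUpgradeLine
import Literature.Analysis.FluidPDE.LongTimeAveragePeriodic
import Literature.Analysis.FunctionSpaces.TorusFourierCalculus
import Literature.Analysis.FunctionSpaces.TorusCalculusProofs
import Literature.Analysis.FunctionSpaces.TorusSpaceTime
import Literature.Analysis.FunctionSpaces.TorusClassicalNSUniqueness

/-!
# Stub `stub_steadyWindow` of the line `malkin-cone-group-orbits`
# (crux stmt-AnomalousDissipation-1144, `BaireTransfer.RobustLoudUpgrade`)

`persistSteady S a E ε ⊆ interior (loud S a E ε)`: a mean-zero classical steady state `u₀` of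
`NS_ν(f_c)` with STRICT budgets `∫‖u₀‖² < E`, `ν‖∇u₀‖₂² > ε` that persists `H¹`-continuously
under small changes of the force at the same viscosity (`SteadyPersistsAt`) makes a whole ball
around `c` loud: every nearby force `f_{c'}` carries a steady classical state `u'` that is
`H¹`-close to `u₀`; `t ↦ u'` is a `1`-periodic classical solution, and its budgets `∫‖u'‖²`,
`ν‖∇u'‖₂²` stay within the strict slack of those of `u₀` by the elementary Peter–Paul inequality
`‖a + b‖² ≤ (1+η)‖a‖² + (1+η⁻¹)‖b‖²` integrated over `T³`.  Hence `ball c r ⊆ loud`, so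
`c ∈ interior loud`.

References: Temam, *Navier–Stokes Equations* (1979) Ch. II §1 (steady states); the vocabulary
module `Theorems/BaireTransferRobustLoudUpgradeLine.lean`; patterns from
`Cruxes/RobustLoudUpgrade/Disproof.lean` §6 (`meanEnergy_sh`, `meanDissipation_sh`,
`cLam_mem_loud`) and §9 (`meanDissipation_eq_period_mean`).
-/

-- `Summit.<Summit>.<Problem>` is the tree's mandated summit-side namespace (CONVENTIONS §2); for this
-- single-conjunct summit the two coincide, so the duplicate is deliberate.
set_option linter.dupNamespace false

noncomputable section

open scoped BigOperators Topology
open Filter Set Function TopologicalSpace MeasureTheory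

namespace Summit.AnomalousDissipation.AnomalousDissipation.Theorems.RobustLoudUpgrade.SteadyWindow

open Literature.Analysis.FunctionSpaces Literature.Analysis.FunctionSpaces.Torus
open Literature.Analysis.FluidPDE
open Summit.AnomalousDissipation.AnomalousDissipation.Theses.BaireTransfer

/-! ## Elementary inequalities -/

/-- Peter–Paul: `‖a + b‖² ≤ (1+η)‖a‖² + (1+η⁻¹)‖b‖²` for `η > 0`. [folklore] -/
theorem norm_add_sq_le {F : Type*} [NormedAddCommGroup F] (a b : F) {η : ℝ} (hη : 0 < η) :
    ‖a + b‖ ^ 2 ≤ (1 + η) * ‖a‖ ^ 2 + (1 + η⁻¹) * ‖b‖ ^ 2 := by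
  have h1 : ‖a + b‖ ^ 2 ≤ (‖a‖ + ‖b‖) ^ 2 :=
    pow_le_pow_left₀ (norm_nonneg _) (norm_add_le a b) 2
  have hη' : η ≠ 0 := hη.ne'
  have h2 : η * ‖a‖ ^ 2 + η⁻¹ * ‖b‖ ^ 2 - 2 * ‖a‖ * ‖b‖ = η⁻¹ * (η * ‖a‖ - ‖b‖) ^ 2 := by
    field_simp
    ring
  have h3 : 0 ≤ η⁻¹ * (η * ‖a‖ - ‖b‖) ^ 2 := by positivity
  nlinarith [h1, h2, h3]

/-- Energies move continuously in `L²`: `∫‖u'‖² ≤ (1+η)∫‖u₀‖² + (1+η⁻¹)∫‖u' − u₀‖²` for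
continuous fields on `T³`. [folklore] -/
theorem integral_norm_sq_le {u₀ u' : UnitAddTorus (Fin 3) → EuclideanSpace ℝ (Fin 3)}
    (h₀ : Continuous u₀) (h' : Continuous u') {η : ℝ} (hη : 0 < η) :
    ∫ x, ‖u' x‖ ^ 2 ≤ (1 + η) * (∫ x, ‖u₀ x‖ ^ 2) + (1 + η⁻¹) * ∫ x, ‖u' x - u₀ x‖ ^ 2 := by
  have hi₀ : Integrable (fun x => ‖u₀ x‖ ^ 2) := (h₀.norm.pow 2).integrable_unitAddTorus
  have hi₁ : Integrable (fun x => ‖u' x - u₀ x‖ ^ 2) :=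
    ((h'.sub h₀).norm.pow 2).integrable_unitAddTorus
  have hi' : Integrable (fun x => ‖u' x‖ ^ 2) := (h'.norm.pow 2).integrable_unitAddTorus
  rw [← integral_const_mul, ← integral_const_mul,
    ← integral_add (hi₀.const_mul _) (hi₁.const_mul _)]
  refine integral_mono hi' ((hi₀.const_mul _).add (hi₁.const_mul _)) fun x => ?_
  have := norm_add_sq_le (u₀ x) (u' x - u₀ x) hη
  rwa [add_sub_cancel] at this

/-- `x ↦ ∑ᵢ ‖∂ᵢ v x‖²` is integrable (indeed continuous) for smooth `v`. [folklore] -/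
theorem integrable_sum_norm_partialDeriv_sq {v : UnitAddTorus (Fin 3) → EuclideanSpace ℝ (Fin 3)}
    (hv : IsSmooth v) : Integrable (fun x => ∑ i, ‖partialDeriv i v x‖ ^ 2) := by
  refine Continuous.integrable_unitAddTorus ?_
  exact continuous_finsetSum _ fun i _ => ((hv.partialDeriv i).continuous.norm.pow 2)

/-- Dissipations move continuously in `H¹`:
`‖∇u₀‖₂² ≤ (1+η)‖∇u'‖₂² + (1+η⁻¹)‖∇(u' − u₀)‖₂²` for smooth fields on `T³` (pointwise gradients,
`∂ᵢ(u' − u₀) = ∂ᵢu' − ∂ᵢu₀` by `Torus.partialDeriv_sub`). [folklore] -/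
theorem gradNormSq_le {u₀ u' : UnitAddTorus (Fin 3) → EuclideanSpace ℝ (Fin 3)}
    (h₀ : IsSmooth u₀) (h' : IsSmooth u') {η : ℝ} (hη : 0 < η) :
    gradNormSq u₀ ≤
      (1 + η) * gradNormSq u' + (1 + η⁻¹) * gradNormSq (fun x => u' x - u₀ x) := by
  have hd : IsSmooth (fun x => u' x - u₀ x) := h'.sub h₀
  unfold gradNormSq
  rw [← integral_const_mul, ← integral_const_mul,
    ← integral_add ((integrable_sum_norm_partialDeriv_sq h').const_mul _)
      ((integrable_sum_norm_partialDeriv_sq hd).const_mul _)]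
  refine integral_mono (integrable_sum_norm_partialDeriv_sq h₀)
    (((integrable_sum_norm_partialDeriv_sq h').const_mul _).add
      ((integrable_sum_norm_partialDeriv_sq hd).const_mul _)) fun x => ?_
  dsimp only
  rw [Finset.mul_sum, Finset.mul_sum, ← Finset.sum_add_distrib]
  refine Finset.sum_le_sum fun i _ => ?_
  have hsub : partialDeriv i (fun x => u' x - u₀ x) x =
      partialDeriv i u' x - partialDeriv i u₀ x :=
    congrFun (Torus.partialDeriv_sub (h'.isContDiff (by simp)) (h₀.isContDiff (by simp)) i) x
  have key :=
    norm_add_sq_le (partialDeriv i u' x) (-(partialDeriv i (fun x => u' x - u₀ x) x)) hη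
  rw [norm_neg, hsub, neg_sub, add_sub_cancel] at key
  rwa [hsub]

/-! ## Budgets of a steady state viewed as a `1`-periodic space–time field -/

/-- Mean energy of a steady field: `⟨‖u‖₂²⟩ = ∫‖v‖²`.
(pattern from Cruxes/RobustLoudUpgrade/Disproof.lean §6 `meanEnergy_sh`) [folklore] -/
theorem meanEnergy_const (v : UnitAddTorus (Fin 3) → EuclideanSpace ℝ (Fin 3)) :
    meanEnergy (fun _ : ℝ => v) = ∫ x, ‖v x‖ ^ 2 := by
  rw [meanEnergy_eq_of_periodic (τ := 1) (fun _ => rfl) one_pos]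
  simp

/-- Mean dissipation of a smooth steady field: `⟨ν‖∇u‖₂²⟩ = ν‖∇v‖₂²` with POINTWISE gradients
(`gradNormSq_eq_toReal_eGradNormSq_holds`).
(pattern from Cruxes/RobustLoudUpgrade/Disproof.lean §9 `meanDissipation_eq_period_mean`) [folklore] -/
theorem meanDissipation_const (ν : ℝ) {v : UnitAddTorus (Fin 3) → EuclideanSpace ℝ (Fin 3)}
    (hv : IsSmooth v) : meanDissipation ν (fun _ : ℝ => v) = ν * gradNormSq v := by
  rw [meanDissipation_eq_of_periodic (τ := 1) (fun _ => rfl) one_pos,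
    gradNormSq_eq_toReal_eGradNormSq_holds hv]
  simp

/-! ## The stub -/

/-- **Steady window** (registered stub `stub_steadyWindow` of the line `malkin-cone-group-orbits`):
a persistent mean-zero loud steady witness with strict budgets makes a neighbourhood of its force
loud, `persistSteady S a E ε ⊆ interior (loud S a E ε)`.  Proof: pick `η > 0` inside the strict
slack (`(1+η)∫‖u₀‖² < E`, `(1+η)ε < ν‖∇u₀‖₂²`), then `δ > 0` absorbing an `H¹`-perturbation of
squared size `δ`; `SteadyPersistsAt` gives a ball of forces whose steady states `u'` satisfy
`h1DistSq u' u₀ < δ`, and each `t ↦ u'` is a `1`-periodic classical loud witness at the same `ν`.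
[folklore] -/
theorem stub_steadyWindow : ∀ (S : Finset (Fin 3 → ℤ)) (a E ε : ℝ), persistSteady S a E ε ⊆ interior (loud S a E ε) := by
  intro S a E ε c hc
  obtain ⟨ν, hν, hνa, u₀, p₀, hst, -, hE, hε, hpers⟩ := hc
  have hsm₀ : IsSmooth u₀ := hst.smooth_velocity.isSmooth_slice (Set.mem_univ (0 : ℝ))
  -- the budgets of `u₀`, as integrals over `T³`
  set A₀ : ℝ := ∫ x, ‖u₀ x‖ ^ 2 with hA₀
  set G₀ : ℝ := gradNormSq u₀ with hG₀
  have hA : A₀ < E := by rwa [meanEnergy_const] at hE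
  have hG : ε < ν * G₀ := by rwa [meanDissipation_const ν hsm₀] at hε
  -- slack: `η > 0` with `(1+η)A₀ < E`, `(1+η)ε < νG₀`
  obtain ⟨η, ⟨hηE, hηε⟩, hη0⟩ :
      ∃ η : ℝ, ((1 + η) * A₀ < E ∧ (1 + η) * ε < ν * G₀) ∧ 0 < η := by
    have h1 : ∀ᶠ η : ℝ in 𝓝 0, (1 + η) * A₀ < E :=
      Filter.Tendsto.eventually_lt_const (v := (1 + 0) * A₀) (by simpa using hA)
        (((continuous_const.add continuous_id).mul continuous_const).tendsto' _ _ rfl)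
    have h2 : ∀ᶠ η : ℝ in 𝓝 0, (1 + η) * ε < ν * G₀ :=
      Filter.Tendsto.eventually_lt_const (v := (1 + 0) * ε) (by simpa using hG)
        (((continuous_const.add continuous_id).mul continuous_const).tendsto' _ _ rfl)
    exact (((h1.and h2).filter_mono nhdsWithin_le_nhds).and
      (self_mem_nhdsWithin : Set.Ioi (0 : ℝ) ∈ 𝓝[>] (0 : ℝ))).exists
  -- then `δ > 0` absorbing the `H¹`-perturbation
  obtain ⟨δ, ⟨hδE, hδε⟩, hδ0⟩ : ∃ δ : ℝ, ((1 + η) * A₀ + (1 + η⁻¹) * δ < E ∧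
      (1 + η) * ε + ν * ((1 + η⁻¹) * δ) < ν * G₀) ∧ 0 < δ := by
    have h1 : ∀ᶠ δ : ℝ in 𝓝 0, (1 + η) * A₀ + (1 + η⁻¹) * δ < E :=
      Filter.Tendsto.eventually_lt_const (v := (1 + η) * A₀ + (1 + η⁻¹) * 0) (by simpa using hηE)
        ((continuous_const.add (continuous_const.mul continuous_id)).tendsto' _ _ rfl)
    have h2 : ∀ᶠ δ : ℝ in 𝓝 0, (1 + η) * ε + ν * ((1 + η⁻¹) * δ) < ν * G₀ :=
      Filter.Tendsto.eventually_lt_const (v := (1 + η) * ε + ν * ((1 + η⁻¹) * 0))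
        (by simpa using hηε)
        ((continuous_const.add
          (continuous_const.mul (continuous_const.mul continuous_id))).tendsto' _ _ rfl)
    exact (((h1.and h2).filter_mono nhdsWithin_le_nhds).and
      (self_mem_nhdsWithin : Set.Ioi (0 : ℝ) ∈ 𝓝[>] (0 : ℝ))).exists
  -- persistence gives a ball of forces with `H¹`-close steady states
  obtain ⟨r, hr, hball⟩ := hpers δ hδ0
  have hsub : Metric.ball c r ⊆ loud S a E ε := by
    intro c' hc'
    obtain ⟨u', p', hst', -, hdist⟩ := hball c' (Metric.mem_ball.1 hc')
    have hsm' : IsSmooth u' := hst'.smooth_velocity.isSmooth_slice (Set.mem_univ (0 : ℝ))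
    -- split the squared `H¹` distance into its two nonnegative parts
    have hL2 : 0 ≤ ∫ x, ‖u' x - u₀ x‖ ^ 2 := integral_nonneg fun _ => sq_nonneg _
    have hH1 : 0 ≤ gradNormSq (fun x => u' x - u₀ x) := gradNormSq_nonneg _
    have hdist' : (∫ x, ‖u' x - u₀ x‖ ^ 2) + gradNormSq (fun x => u' x - u₀ x) < δ := hdist
    have hdL : ∫ x, ‖u' x - u₀ x‖ ^ 2 ≤ δ := by linarith
    have hdG : gradNormSq (fun x => u' x - u₀ x) ≤ δ := by linarith
    have hη1 : 0 ≤ 1 + η⁻¹ := by positivity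
    -- energy budget `∫‖u'‖² ≤ E`
    have hEn : meanEnergy (fun _ : ℝ => u') ≤ E := by
      rw [meanEnergy_const]
      have h := integral_norm_sq_le hsm₀.continuous hsm'.continuous hη0
      have : (1 + η⁻¹) * ∫ x, ‖u' x - u₀ x‖ ^ 2 ≤ (1 + η⁻¹) * δ :=
        mul_le_mul_of_nonneg_left hdL hη1
      linarith
    -- dissipation budget `ε ≤ ν‖∇u'‖₂²`
    have hDi : ε ≤ meanDissipation ν (fun _ : ℝ => u') := by
      rw [meanDissipation_const ν hsm']
      have h := gradNormSq_le hsm₀ hsm' hη0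
      have h1 : (1 + η⁻¹) * gradNormSq (fun x => u' x - u₀ x) ≤ (1 + η⁻¹) * δ :=
        mul_le_mul_of_nonneg_left hdG hη1
      have h2 : ν * G₀ ≤ ν * ((1 + η) * gradNormSq u' + (1 + η⁻¹) * δ) :=
        mul_le_mul_of_nonneg_left (by linarith) hν.le
      have h3 : (1 + η) * ε < (1 + η) * (ν * gradNormSq u') := by nlinarith
      exact (lt_of_mul_lt_mul_left h3 (by linarith)).le
    -- pattern from Cruxes/RobustLoudUpgrade/Disproof.lean §6 `cLam_mem_loud`
    exact ⟨ν, hν, hνa, 1, fun _ => u', fun _ => p', one_pos, hst', fun _ => rfl, hEn, hDi⟩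
  exact interior_mono hsub (by rwa [Metric.isOpen_ball.interior_eq, Metric.mem_ball, dist_self])

end Summit.AnomalousDissipation.AnomalousDissipation.Theorems.RobustLoudUpgrade.SteadyWindow

end
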